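import Summits.Ventures.PercRepro.RankLevelSetHallCoopShareBounds

/-!
# PercRepro — THE COLOOP-SHARE KERNEL, PART 3: EVERY MEMBER RECEIVES AT LEAST `Φ(p,q)`, AND THE UP-HALL FORM OF C-044
AT THE TIGHT LAYER FOR `k = 2` (p4, gen 37; paper proofs/P4-CRUX-K2.md, Lemma 5 and the Theorem)

For a member `Z` with `F = cl Z`, `D = F ∖ Z` (`d = #D ≤ q`) and `O = E ∖ F` (`ω = #O = q + 2 − d`), the `Y`-sets
`R ∪ {o}` (`Z ⊆ R ⊆ F`, `o ∈ O`) are distinct, `C(d, j)` of them at each level `#R = q + j` for each of the `ω` outside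
elements, and each pays at least `1 / C(q + j + 1, j + 1)` (`csWeight_insert_ge`).  The arithmetic identity
`receipt_bound` turns the sum into `≥ (q + 2)/(q + 1) = Φ(q + 2, q)` (`phiK_le_csWeight_recv`).  With the loads
(`csWeight_load_le_one`) night-1's `hallUp_of_fracMatching` yields **`hallUp_of_ncard_eq_k2`**: at `#E = 2q + 2`, for every
family `𝒜` of members of the cell `(q + 2, q)`, `Φ(q+2, q) · #𝒜 ≤ #upNbhd(𝒜)` — the UP-Hall form of C-044 at the tight
layer, `k = 2`, for every finite matroid.

* `phiK_k2` — `Φ(q + 2, q) = (q + 2)/(q + 1)`;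
* **`phiK_le_csWeight_recv`** — every member receives at least `Φ(q + 2, q)`;
* **`hallUp_of_ncard_eq_k2`** — the UP-Hall form of C-044 at the tight layer for `k = 2`.
Axioms: standard.
-/

namespace PercRepro

open Set Matroid Finset

variable {α : Type} (M : Matroid α) [M.Finite]

/-- `Φ(q + 2, q) = (q + 2)/(q + 1)`. -/
theorem phiK_k2 (q : ℕ) : phiK (q + 2) q = ((q : ℚ) + 2) / ((q : ℚ) + 1) := by
  unfold phiK
  have hIoo : Finset.Ioo q (q + 2) = {q + 1} := by
    ext x
    simp only [Finset.mem_Ioo, Finset.mem_singleton]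
    omega
  rw [hIoo, Finset.sum_singleton]
  -- C(2q+2, q+2)·(q+2) = C(2q+2, q+1)·(q+1)
  have h := Nat.choose_succ_right_eq (q + 2 + q) (q + 1)
  have h' : ((q + 2 + q).choose (q + 2) : ℚ) * ((q : ℚ) + 2) = ((q + 2 + q).choose (q + 1) : ℚ) * ((q : ℚ) + 1) := by
    have e1 : q + 1 + 1 = q + 2 := rfl
    have e2 : q + 2 + q - (q + 1) = q + 1 := by omega
    rw [e1, e2] at h
    have := congrArg (fun n : ℕ => (n : ℚ)) h
    push_cast at this
    linear_combination this
  have hc : ((q + 2 + q).choose (q + 2) : ℚ) ≠ 0 := by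
    have : 0 < (q + 2 + q).choose (q + 2) := Nat.choose_pos (by omega)
    exact_mod_cast this.ne'
  rw [div_eq_div_iff hc (by positivity)]
  linear_combination (-1 : ℚ) * h'

/-- **Every member receives at least `Φ(q + 2, q) = (q+2)/(q+1)`** under the coloop-share kernel at the tight layer:
the sets `R ∪ {o}` (`Z ⊆ R ⊆ cl Z`, `o ∉ cl Z`) are distinct `Y`-sets, each paying at least `1 / C(q + j + 1, j + 1)`
(`#R = q + j`), and there are `C(d, j)` of them at level `j` for each of the `ω = q + 2 − d` outside elements. -/
theorem phiK_le_csWeight_recv (q : ℕ) (hE : M.E.ncard = (q + 2) + q) {Z : Set α}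
    (hZ : Z ∈ cellMembers M (q + 2) q) :
    phiK (q + 2) q ≤ ∑ S ∈ (cellY_finite M (q + 2) q).toFinset, csWeight M q Z S := by
  classical
  have hZE : Z ⊆ M.E := hZ.1
  have hZq : Z.ncard = q := ncard_eq_q_of_mem_cellMembers_tight M hE hZ
  set F : Set α := M.closure Z with hF
  have hFE : F ⊆ M.E := M.closure_subset_ground Z
  have hZF : Z ⊆ F := M.subset_closure Z hZE
  set D : Set α := F \ Z with hD
  set O : Set α := M.E \ F with hO
  have hEfin : M.E.Finite := M.set_finite M.E
  have hFfin : F.Finite := hEfin.subset hFE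
  have hDfin : D.Finite := hFfin.subset sdiff_subset
  have hOfin : O.Finite := hEfin.subset sdiff_subset
  -- d ≤ q: D is independent (inside E ∖ Z) and lies in the rank-q flat F
  have hDind : M.Indep D := (compl_indep_of_mem_U M hE hZ).1.subset (fun x hx => ⟨hFE hx.1, hx.2⟩)
  have hd_le : D.ncard ≤ q := by
    have h := hDind.encard_le_eRk_of_subset (sdiff_subset : D ⊆ F)
    rw [hF, M.eRk_closure_eq, eRk_eq_of_mem_cellMembers M q hZ, ← hDfin.cast_ncard_eq] at h
    exact_mod_cast h
  -- ω = q + 2 − d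
  have hFcard : F.ncard = q + D.ncard := by
    have := Set.ncard_sdiff_add_ncard_of_subset hZF hFfin
    rw [← hD, hZq] at this
    omega
  have hOcard : O.ncard = q + 2 - D.ncard := by
    have := Set.ncard_sdiff_add_ncard_of_subset hFE hEfin
    rw [← hO, hE, hFcard] at this
    omega
  set Df : Finset α := hDfin.toFinset with hDf
  set Of : Finset α := hOfin.toFinset with hOf
  have hDcard : Df.card = D.ncard := by rw [hDf, ← ncard_eq_toFinset_card _ hDfin]
  have hOcard' : Of.card = O.ncard := by rw [hOf, ← ncard_eq_toFinset_card _ hOfin]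
  set Yf : Finset (Set α) := (cellY_finite M (q + 2) q).toFinset with hYf
  have hmemY : ∀ S, S ∈ Yf ↔ S ∈ cellY M (q + 2) q := fun S => by
    rw [hYf, (cellY_finite M (q + 2) q).mem_toFinset]
  -- the pairs (Y', o) and the map φ
  set P : Finset (Finset α × α) := Df.powerset ×ˢ Of with hP
  let φ : Finset α × α → Set α := fun p => insert p.2 (Z ∪ (p.1 : Set α))
  have hpair : ∀ p ∈ P, (p.1 : Set α) ⊆ D ∧ p.2 ∈ M.E ∧ p.2 ∉ F := by
    intro p hp
    rw [hP, Finset.mem_product, Finset.mem_powerset] at hp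
    obtain ⟨h1, h2⟩ := hp
    refine ⟨?_, ?_, ?_⟩
    · intro x hx
      have := h1 (Finset.mem_coe.1 hx)
      rw [hDf, Set.Finite.mem_toFinset] at this
      exact this
    · rw [hOf, Set.Finite.mem_toFinset] at h2
      exact h2.1
    · rw [hOf, Set.Finite.mem_toFinset] at h2
      exact h2.2
  have hR : ∀ p ∈ P, Z ⊆ Z ∪ (p.1 : Set α) ∧ Z ∪ (p.1 : Set α) ⊆ F := by
    intro p hp
    obtain ⟨h1, -, -⟩ := hpair p hp
    exact ⟨Set.subset_union_left, Set.union_subset hZF (h1.trans sdiff_subset)⟩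
  have hRcard : ∀ p ∈ P, (Z ∪ (p.1 : Set α)).ncard = q + p.1.card := by
    intro p hp
    obtain ⟨h1, -, -⟩ := hpair p hp
    have hdisj : Disjoint Z (p.1 : Set α) := by
      rw [Set.disjoint_left]
      intro x hxZ hxY
      exact (h1 hxY).2 hxZ
    rw [Set.ncard_union_eq hdisj (M.set_finite Z hZE) (Finset.finite_toSet _), hZq, ncard_coe_finset]
  -- the image lies in Yf
  have himage : P.image φ ⊆ Yf := by
    intro S hS
    rw [Finset.mem_image] at hS
    obtain ⟨p, hp, rfl⟩ := hS
    obtain ⟨-, ho, hocl⟩ := hpair p hp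
    obtain ⟨hZR, hRcl⟩ := hR p hp
    rw [hmemY]
    exact mem_cellY_insert M q hZ hZR hRcl ho hocl
  -- φ is injective on P
  have hinj : ∀ p ∈ P, ∀ p' ∈ P, φ p = φ p' → p = p' := by
    intro p hp p' hp' heq
    obtain ⟨h1, -, hocl⟩ := hpair p hp
    obtain ⟨h1', -, hocl'⟩ := hpair p' hp'
    obtain ⟨hZR, hRcl⟩ := hR p hp
    obtain ⟨hZR', hRcl'⟩ := hR p' hp'
    obtain ⟨hs1, hs2⟩ := insert_sdiff_closure_eq M Z _ hRcl hocl
    obtain ⟨hs1', hs2'⟩ := insert_sdiff_closure_eq M Z _ hRcl' hocl'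
    have ho : p.2 = p'.2 := by
      have : ({p.2} : Set α) = {p'.2} := by
        rw [← hs1, ← hs1']
        show φ p \ M.closure Z = φ p' \ M.closure Z
        rw [heq]
      exact Set.singleton_eq_singleton_iff.1 this
    have hY : p.1 = p'.1 := by
      have hU : Z ∪ (p.1 : Set α) = Z ∪ (p'.1 : Set α) := by
        rw [← hs2, ← hs2']
        show φ p ∩ M.closure Z = φ p' ∩ M.closure Z
        rw [heq]
      have hdiff : ∀ (Y : Finset α), (Y : Set α) ⊆ D → (Z ∪ (Y : Set α)) \ Z = (Y : Set α) := by
        intro Y hY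
        ext x
        simp only [Set.mem_sdiff, Set.mem_union]
        constructor
        · rintro ⟨h | h, hx⟩
          · exact absurd h hx
          · exact h
        · intro h
          exact ⟨Or.inr h, (hY h).2⟩
      have : (p.1 : Set α) = (p'.1 : Set α) := by
        rw [← hdiff p.1 h1, ← hdiff p'.1 h1', hU]
      exact Finset.coe_injective this
    exact Prod.ext hY ho
  -- the sum over Yf dominates the sum over the image, which is the sum over the pairs
  have hstep1 : ∑ S ∈ P.image φ, csWeight M q Z S ≤ ∑ S ∈ Yf, csWeight M q Z S :=
    Finset.sum_le_sum_of_subset_of_nonneg himage (fun S _ _ => csWeight_nonneg M q Z S)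
  have hstep2 : ∑ S ∈ P.image φ, csWeight M q Z S = ∑ p ∈ P, csWeight M q Z (φ p) :=
    Finset.sum_image hinj
  -- each pair pays at least 1 / C(q + #Y' + 1, #Y' + 1)
  have hstep3 : ∑ p ∈ P, (1 / (((q + p.1.card + 1).choose (p.1.card + 1) : ℕ) : ℚ))
      ≤ ∑ p ∈ P, csWeight M q Z (φ p) := by
    apply Finset.sum_le_sum
    intro p hp
    obtain ⟨-, ho, hocl⟩ := hpair p hp
    obtain ⟨hZR, hRcl⟩ := hR p hp
    have h := csWeight_insert_ge M q hE hZ hZR hRcl ho hocl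
    rw [hRcard p hp, Nat.add_sub_cancel_left] at h
    exact h
  -- evaluate the pair sum: Σ_{Y'} Σ_o = #Of · Σ_{Y'} 1/C(q + #Y' + 1, #Y' + 1) = ω · Σ_j C(d, j)/C(q+j+1, j+1)
  have hstep4 : ∑ p ∈ P, (1 / (((q + p.1.card + 1).choose (p.1.card + 1) : ℕ) : ℚ))
      = (Of.card : ℚ) * ∑ j ∈ Finset.range (Df.card + 1),
          ((Df.card.choose j : ℕ) : ℚ) * (1 / (((q + j + 1).choose (j + 1) : ℕ) : ℚ)) := by
    rw [hP, Finset.sum_product]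
    simp only [Finset.sum_const, nsmul_eq_mul]
    rw [← Finset.mul_sum]
    congr 1
    rw [Finset.sum_powerset_apply_card (fun m => (1 / (((q + m + 1).choose (m + 1) : ℕ) : ℚ)))]
    apply Finset.sum_congr rfl
    intro j _
    rw [nsmul_eq_mul]
  -- the arithmetic bound
  have harith := CoopShare.receipt_bound q D.ncard hd_le
  have hOq : (Of.card : ℚ) = (q : ℚ) + 2 - (D.ncard : ℚ) := by
    rw [hOcard', hOcard, Nat.cast_sub (by omega)]
    push_cast
    ring
  rw [phiK_k2]
  calc ((q : ℚ) + 2) / ((q : ℚ) + 1)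
      ≤ ((q : ℚ) + 2 - D.ncard) * ∑ j ∈ Finset.range (D.ncard + 1),
          (D.ncard.choose j : ℚ) / ((q + j + 1).choose (j + 1) : ℚ) := harith
    _ = (Of.card : ℚ) * ∑ j ∈ Finset.range (Df.card + 1),
          ((Df.card.choose j : ℕ) : ℚ) * (1 / (((q + j + 1).choose (j + 1) : ℕ) : ℚ)) := by
        rw [hOq, hDcard]
        congr 1
        apply Finset.sum_congr rfl
        intro j _
        rw [mul_one_div]
    _ = ∑ p ∈ P, (1 / (((q + p.1.card + 1).choose (p.1.card + 1) : ℕ) : ℚ)) := hstep4.symm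
    _ ≤ ∑ p ∈ P, csWeight M q Z (φ p) := hstep3
    _ = ∑ S ∈ P.image φ, csWeight M q Z S := hstep2.symm
    _ ≤ ∑ S ∈ Yf, csWeight M q Z S := hstep1

/-- **THE UP-HALL FORM OF C-044 AT THE TIGHT LAYER, `k = 2`**: for every finite matroid with `#E = 2q + 2` and every
family `𝒜` of members of the cell `(q + 2, q)`, `Φ(q+2, q) · #𝒜 ≤ #upNbhd(𝒜)` — by night-1's
`hallUp_of_fracMatching` applied to the coloop-share kernel (loads `≤ 1`, receipts `≥ Φ`). -/
theorem hallUp_of_ncard_eq_k2 (q : ℕ) (hE : M.E.ncard = (q + 2) + q) (𝒜 : Set (Set α))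
    (h𝒜 : 𝒜 ⊆ cellMembers M (q + 2) q) :
    phiK (q + 2) q * (𝒜.ncard : ℚ) ≤ ((upNbhd M (q + 2) q 𝒜).ncard : ℚ) :=
  hallUp_of_fracMatching M (q + 2) q (csWeight M q) (csWeight_nonneg M q) (subset_of_csWeight_ne_zero M q)
    (fun _ hZ => phiK_le_csWeight_recv M q hE hZ) (fun _ hS => csWeight_load_le_one M q hS) 𝒜 h𝒜

end PercRepro
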